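/-
Copyright: cell `pub-balaban-gaps` (G2), seat ne6 (row NE7b), `prover-pub-balaban-gaps-ne6-g17-0`. Project licence.
-/
import Summits.QuantumFields.BalabanUV.T4Continuum.Spine.NE7b.CompactFibrePlaquetteMassSU2Monotone
import Summits.QuantumFields.BalabanUV.T4Continuum.Spine.NE7b.CompactFibrePlaquetteMassSU2Limit
import Summits.QuantumFields.BalabanUV.T4Continuum.Spine.NE7b.CompactFibrePlaquetteMassSUN
import Summits.QuantumFields.BalabanUV.T4Continuum.Spine.NE7b.CompactFibrePlaquetteMassSU2LaplaceFloor

/-!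
# THE SHARP CEILING OF THE `SU(2)` ONE-PLAQUETTE MASS AT EVERY COUPLING: `Z_{SU(2)}(β) < (2√π)⁻¹·β^{−3∕2}` for all `β > 0`, the constant being the supremum,
# and the free energy by value `log(2√π) < −log Z_{SU(2)}(β) − (3∕2)·log β ≤ 3∕2 − log(3√3∕8)` for `β ≥ 3∕4`
# (row NE7b, node U5c; MODEL, [folklore]; census junction J3 = V44 `…Monotone` + V45 `…Limit` (+ V39, V47))

Cell `pub-balaban-gaps` (G2 spine census) for the `pub-balaban` T⁴ crux NE7b (`T4WeightBudget.RelWeightBound`; NOT PRINTED, NOT PROVED).  Junction only: V44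
`CompactFibrePlaquetteMassSU2Monotone.scaled_plaquetteMass_SU2_strictMonoOn` ∕ `tangentFloor_le_plaquetteMass_SU2` + V45 `CompactFibrePlaquetteMassSU2Limit.tendsto_scaled_plaquetteMass_SU2`
(+ V39 `CompactFibrePlaquetteMassSUN.linkMass_SU_eq` and the OWNER's `BarePartitionFnNoFloor.partitionFn_T4_le` for the owner's currency; + V47
`CompactFibrePlaquetteMassSU2LaplaceFloor.laplaceFloor_le_scaled_plaquetteMass_SU2` for the two-sided rate).
No `def`; zero `sorry`; nothing of Bałaban's asserted.

WHAT IS PROVED ([folklore]; `Z(β) = ∫ e^{−β·Re tr(1−U)} dHaar_{SU(2)}(U)`, `f(β) = (√β)³·Z(β)`):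
* **`scaled_plaquetteMass_SU2_lt_limit`**: `f(β) < (2√π)⁻¹` for every `β ≥ 0` (strictly increasing to its limit); **`isLUB_scaled_plaquetteMass_SU2`**: `(2√π)⁻¹ = sup_{β ≥ 0} f(β)`;
* **`plaquetteMass_SU2_lt_sharp`** ∕ `plaquetteMass_SU2_le_sharp`: `Z(β) < (2√π)⁻¹·((√β)⁻¹)³` for every `β > 0` — V41's ceiling `π²√π∕16 = 1.0933` replaced by the SHARP
  `(2√π)⁻¹ = 0.28209` (refuter instrument no. 13's «slack ×3.88» → ×1); with V44's floor, **`scaled_plaquetteMass_SU2_mem_Ico`**: `f(β) ∈ [(3√3∕8)e^{−3∕2}, (2√π)⁻¹) =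
  [0.14493, 0.28209)` for `β ≥ 3∕4`;
* **`lt_freeEnergy_SU2`** (`β > 0`): `log(2√π) < −log Z(β) − (3∕2)·log β`; **`freeEnergy_SU2_le`** (`β ≥ 3∕4`): `… ≤ 3∕2 − log(3√3∕8)` — the bracket `(1.2655, 1.9315]`
  for V39's `c₁` (V43 had `|…| ≤ 1 + log 8 = 3.079` on `β ≥ 1∕4`; the lower end is the limit, V45);
* **`halvedAction_moment_lt_sharp`** (`β > 0`, `0 < δ < 1`): `Z((1−δ)β) < (1−δ)^{−3∕2}·Z(β)` — J2's D = 1 letter is STRICT at every finite coupling;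
* the OWNER's currency (`linkMass β = Z(β∕2)`, V39): **`linkMass_SU2_lt_sharp`**, `tangentFloor_le_linkMass_SU2` (`β ≥ 3∕2`), **`partitionFn_T4_SU2_le_sharp`**
  (`Z_K(β) ≤ (0.28209·(β∕2)^{−3∕2})^{2L^{m+K}}`, every `K`, every `β > 0`; base `< 1` once `β > 0.860…` — V43's `2.12…`);
* with V47's floor: **`abs_scaled_plaquetteMass_SU2_sub_limit_le`** (`|f(β) − (2√π)⁻¹| ≤ (2√π)⁻¹∕(2β)`, every `β > 0` — the Laplace limit WITH RATE, two-sided).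

HONEST REMARKS.  MODEL ∕ [folklore]; ONE `SU(2)` plaquette variable under Haar — NOT the interacting measure; N = 3 not treated; (A3) ∕ (A1c) NOT asserted; NC-NE7b-α UNRULED.
BY-NAME EFFECT ON THE WALL: NONE.  NE7b NOT PRINTED ∕ NOT PROVED; spine PROVED 0∕9; rung (B)+1 on ONE finite T⁴ — NOT infinite volume, NOT the mass gap, NOT Clay.
HONEST DEPENDENCY: continuum YM on T⁴ ⇐ BetaPertH ∧ nine spine estimates (0/9 proved); BetaPertH ⇐ (D1) ∧ (D4) ∧ CAP+tail;
G-an2-4 gates asym, D1 and NE2/3/4.  This file changes none of it.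
-/

set_option autoImplicit false

noncomputable section

open Real Set MeasureTheory Filter Topology
open Literature.MathematicalPhysics.QuantumFieldTheory (haarProbability)
open Summit.QuantumFields.BalabanUV.T4Continuum.NE7b.CompactFibrePlaquetteMassSU2Monotone (scaled_plaquetteMass_SU2_strictMonoOn scaled_plaquetteMass_SU2_le
  scaled_plaquetteMass_SU2_lt tangentFloor_le_plaquetteMass_SU2)
open Summit.QuantumFields.BalabanUV.T4Continuum.NE7b.CompactFibrePlaquetteMassSU2Limit (tendsto_scaled_plaquetteMass_SU2)
open Literature.MathematicalPhysics.QuantumFieldTheory.Balaban1983to89.Missing (partitionFn)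
open Literature.MathematicalPhysics.QuantumFieldTheory.Balaban1983to89.T4Continuum (T4Family)
open Summit.QuantumFields.BalabanUV.T4Continuum.NE7b.BarePartitionFnDecay (linkMass linkMass_nonneg)
open Summit.QuantumFields.BalabanUV.T4Continuum.NE7b.BarePartitionFnNoFloor (partitionFn_T4_le)
open Summit.QuantumFields.BalabanUV.T4Continuum.NE7b.CompactFibrePlaquetteMassSUN (linkMass_SU_eq)
open Summit.QuantumFields.BalabanUV.T4Continuum.NE7b.CompactFibrePlaquetteMassSU2LaplaceFloor (laplaceFloor_le_scaled_plaquetteMass_SU2)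

namespace Summit.QuantumFields.BalabanUV.T4Continuum.NE7b.CompactFibrePlaquetteMassSU2Sharp

/-- **`f(β) < (2√π)⁻¹` FOR EVERY `β ≥ 0`**: the scaled mass `(√β)³·∫ e^{−β·Re tr(1−U)} dHaar_{SU(2)}` is strictly below its limit (V44 strictly increasing, V45 the limit). [folklore] -/
theorem scaled_plaquetteMass_SU2_lt_limit {β : ℝ} (hβ : 0 ≤ β) :
    Real.sqrt β ^ 3 * ∫ U, Real.exp (-(β * (Matrix.trace (1 - (U : Matrix (Fin 2) (Fin 2) ℂ))).re)) ∂(haarProbability (Matrix.specialUnitaryGroup (Fin 2) ℂ))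
      < (2 * Real.sqrt Real.pi)⁻¹ := by
  have hle : Real.sqrt (β + 1) ^ 3 * ∫ U, Real.exp (-((β + 1) * (Matrix.trace (1 - (U : Matrix (Fin 2) (Fin 2) ℂ))).re)) ∂(haarProbability (Matrix.specialUnitaryGroup (Fin 2) ℂ))
      ≤ (2 * Real.sqrt Real.pi)⁻¹ := by
    refine ge_of_tendsto tendsto_scaled_plaquetteMass_SU2 ?_
    filter_upwards [eventually_ge_atTop (β + 1)] with x hx
    exact scaled_plaquetteMass_SU2_le (by linarith) hx
  exact (scaled_plaquetteMass_SU2_lt hβ (by linarith)).trans_le hle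

/-- **`(2√π)⁻¹` IS THE SUPREMUM of `{f(β) : β ≥ 0}`** (upper bound by the previous theorem, approached by V45's limit). [folklore] -/
theorem isLUB_scaled_plaquetteMass_SU2 :
    IsLUB ((fun β : ℝ => Real.sqrt β ^ 3 *
        ∫ U, Real.exp (-(β * (Matrix.trace (1 - (U : Matrix (Fin 2) (Fin 2) ℂ))).re)) ∂(haarProbability (Matrix.specialUnitaryGroup (Fin 2) ℂ))) '' Set.Ici 0)
      ((2 * Real.sqrt Real.pi)⁻¹) := by
  refine ⟨?_, fun b hb => ?_⟩
  · rintro _ ⟨β, hβ, rfl⟩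
    exact (scaled_plaquetteMass_SU2_lt_limit (Set.mem_Ici.1 hβ)).le
  · by_contra hlt
    push Not at hlt
    obtain ⟨β, hβb, hβ0⟩ := ((tendsto_scaled_plaquetteMass_SU2.eventually_const_lt hlt).and (eventually_ge_atTop (0 : ℝ))).exists
    exact absurd (hb ⟨β, Set.mem_Ici.2 hβ0, rfl⟩) (not_le.2 hβb)

/-- **THE SHARP CEILING AT EVERY COUPLING**: for `β > 0`, `∫ e^{−β·Re tr(1−U)} dHaar_{SU(2)}(U) < (2√π)⁻¹·((√β)⁻¹)³` (`0.28209·β^{−3∕2}`; V41: `1.0933·β^{−3∕2}`). [folklore] -/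
theorem plaquetteMass_SU2_lt_sharp {β : ℝ} (hβ : 0 < β) :
    ∫ U, Real.exp (-(β * (Matrix.trace (1 - (U : Matrix (Fin 2) (Fin 2) ℂ))).re)) ∂(haarProbability (Matrix.specialUnitaryGroup (Fin 2) ℂ))
      < (2 * Real.sqrt Real.pi)⁻¹ * ((Real.sqrt β)⁻¹) ^ 3 := by
  have hs : 0 < Real.sqrt β := Real.sqrt_pos.2 hβ
  have h := scaled_plaquetteMass_SU2_lt_limit hβ.le
  rw [inv_pow, ← div_eq_mul_inv, lt_div_iff₀ (pow_pos hs 3)]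
  linarith

/-- The non-strict form of the sharp ceiling. [folklore] -/
theorem plaquetteMass_SU2_le_sharp {β : ℝ} (hβ : 0 < β) :
    ∫ U, Real.exp (-(β * (Matrix.trace (1 - (U : Matrix (Fin 2) (Fin 2) ℂ))).re)) ∂(haarProbability (Matrix.specialUnitaryGroup (Fin 2) ℂ))
      ≤ (2 * Real.sqrt Real.pi)⁻¹ * ((Real.sqrt β)⁻¹) ^ 3 :=
  (plaquetteMass_SU2_lt_sharp hβ).le

/-- **THE BRACKET BY VALUE**: for `β ≥ 3∕4`, `(3√3∕8)·e^{−3∕2} ≤ f(β) < (2√π)⁻¹`, i.e. `f(β) ∈ [0.14493, 0.28209)` (V44's tangent floor + the sharp ceiling). [folklore] -/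
theorem scaled_plaquetteMass_SU2_mem_Ico {β : ℝ} (hβ : 3 / 4 ≤ β) :
    Real.sqrt β ^ 3 * ∫ U, Real.exp (-(β * (Matrix.trace (1 - (U : Matrix (Fin 2) (Fin 2) ℂ))).re)) ∂(haarProbability (Matrix.specialUnitaryGroup (Fin 2) ℂ))
      ∈ Set.Ico (3 * Real.sqrt 3 / 8 * Real.exp (-(3 / 2))) ((2 * Real.sqrt Real.pi)⁻¹) := by
  have hβ0 : 0 < β := by linarith
  have hs : 0 < Real.sqrt β := Real.sqrt_pos.2 hβ0
  refine ⟨?_, scaled_plaquetteMass_SU2_lt_limit hβ0.le⟩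
  have h := tangentFloor_le_plaquetteMass_SU2 hβ
  rw [inv_pow, ← div_eq_mul_inv, div_le_iff₀ (pow_pos hs 3)] at h
  linarith

/-- **THE FREE ENERGY FROM BELOW, SHARP**: for `β > 0`, `log(2√π) < −log ∫ e^{−β·Re tr(1−U)} dHaar_{SU(2)} − (3∕2)·log β` (`log(2√π) = 1.2655…`, the V45 limit). [folklore] -/
theorem lt_freeEnergy_SU2 {β : ℝ} (hβ : 0 < β) :
    Real.log (2 * Real.sqrt Real.pi)
      < -Real.log (∫ U, Real.exp (-(β * (Matrix.trace (1 - (U : Matrix (Fin 2) (Fin 2) ℂ))).re)) ∂(haarProbability (Matrix.specialUnitaryGroup (Fin 2) ℂ)))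
          - 3 / 2 * Real.log β := by
  have hs : 0 < Real.sqrt β := Real.sqrt_pos.2 hβ
  have hL : 0 < (2 * Real.sqrt Real.pi)⁻¹ := by positivity
  set Z := ∫ U, Real.exp (-(β * (Matrix.trace (1 - (U : Matrix (Fin 2) (Fin 2) ℂ))).re)) ∂(haarProbability (Matrix.specialUnitaryGroup (Fin 2) ℂ)) with hZ
  by_cases hZ0 : Z ≤ 0
  · -- impossible: V44's tangent floor gives `0 < Z`
    exfalso
    have hfl := Summit.QuantumFields.BalabanUV.T4Continuum.NE7b.CompactFibrePlaquetteMassSU2Monotone.exp_neg_two_mul_le_plaquetteMass_SU2 hβ.le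
    linarith [Real.exp_pos (-(2 * β))]
  push Not at hZ0
  have hf := scaled_plaquetteMass_SU2_lt_limit hβ.le
  have hflog := Real.log_lt_log (mul_pos (pow_pos hs 3) hZ0) hf
  rw [Real.log_mul (pow_pos hs 3).ne' hZ0.ne', Real.log_pow, Real.log_sqrt hβ.le, Real.log_inv] at hflog
  push_cast at hflog
  linarith

/-- **THE FREE ENERGY FROM ABOVE, BY VALUE**: for `β ≥ 3∕4`, `−log ∫ e^{−β·Re tr(1−U)} dHaar_{SU(2)} − (3∕2)·log β ≤ 3∕2 − log(3√3∕8)` (`= 1.9315…`; V44's tangent floor). [folklore] -/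
theorem freeEnergy_SU2_le {β : ℝ} (hβ : 3 / 4 ≤ β) :
    -Real.log (∫ U, Real.exp (-(β * (Matrix.trace (1 - (U : Matrix (Fin 2) (Fin 2) ℂ))).re)) ∂(haarProbability (Matrix.specialUnitaryGroup (Fin 2) ℂ)))
        - 3 / 2 * Real.log β ≤ 3 / 2 - Real.log (3 * Real.sqrt 3 / 8) := by
  have hβ0 : 0 < β := by linarith
  have hs : 0 < Real.sqrt β := Real.sqrt_pos.2 hβ0
  have hc : 0 < 3 * Real.sqrt 3 / 8 * Real.exp (-(3 / 2)) := by positivity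
  obtain ⟨hlow, _⟩ := scaled_plaquetteMass_SU2_mem_Ico hβ
  set Z := ∫ U, Real.exp (-(β * (Matrix.trace (1 - (U : Matrix (Fin 2) (Fin 2) ℂ))).re)) ∂(haarProbability (Matrix.specialUnitaryGroup (Fin 2) ℂ)) with hZ
  have hZ0 : 0 < Z := by
    by_contra h
    push Not at h
    have : Real.sqrt β ^ 3 * Z ≤ 0 := mul_nonpos_of_nonneg_of_nonpos (pow_pos hs 3).le h
    linarith
  have hlog := Real.log_le_log hc hlow
  rw [Real.log_mul (by positivity) (Real.exp_pos _).ne', Real.log_exp, Real.log_mul (pow_pos hs 3).ne' hZ0.ne', Real.log_pow, Real.log_sqrt hβ0.le] at hlog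
  push_cast at hlog
  linarith

/-- **THE HALVED-ACTION RATIO IS STRICTLY BELOW ITS SHARP CONSTANT AT EVERY FINITE COUPLING**: for `β > 0` and `0 < δ < 1`,
`∫ e^{−(1−δ)β·Re tr(1−U)} dHaar_{SU(2)} < ((√(1−δ))⁻¹)³·∫ e^{−β·Re tr(1−U)} dHaar_{SU(2)}` — J2's `halvedAction_moment_le_sharp` (`≤`, D = 1 by window doubling) is
never an equality (V44's strict monotonicity read at `β₁ = (1−δ)β < β₂ = β`; the refuter's instrument no. 7 saw the ratio `0.9999 → 1`). [folklore] -/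
theorem halvedAction_moment_lt_sharp {β δ : ℝ} (hβ : 0 < β) (hδ0 : 0 < δ) (hδ1 : δ < 1) :
    ∫ U, Real.exp (-((1 - δ) * β * (Matrix.trace (1 - (U : Matrix (Fin 2) (Fin 2) ℂ))).re)) ∂(haarProbability (Matrix.specialUnitaryGroup (Fin 2) ℂ))
      < ((Real.sqrt (1 - δ))⁻¹) ^ 3 *
        ∫ U, Real.exp (-(β * (Matrix.trace (1 - (U : Matrix (Fin 2) (Fin 2) ℂ))).re)) ∂(haarProbability (Matrix.specialUnitaryGroup (Fin 2) ℂ)) := by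
  have h1δ : 0 < 1 - δ := by linarith
  have hβ1 : 0 < (1 - δ) * β := mul_pos h1δ hβ
  have hlt : (1 - δ) * β < β := by nlinarith
  have h := scaled_plaquetteMass_SU2_lt hβ1.le hlt
  have hs1 : 0 < Real.sqrt (1 - δ) := Real.sqrt_pos.2 h1δ
  have hsβ : 0 < Real.sqrt β := Real.sqrt_pos.2 hβ
  have hsprod : Real.sqrt ((1 - δ) * β) = Real.sqrt (1 - δ) * Real.sqrt β := Real.sqrt_mul h1δ.le β
  rw [hsprod, mul_pow] at h
  -- divide the strict inequality by `(√(1−δ))³·(√β)³ > 0`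
  rw [inv_pow, ← div_eq_inv_mul]
  rw [lt_div_iff₀ (pow_pos hs1 3)]
  have hβ3 : 0 < Real.sqrt β ^ 3 := pow_pos hsβ 3
  nlinarith [h, hβ3]

/-! ### The OWNER's currency, sharp (`linkMass β = Z(β∕2)` by V39's `linkMass_SU_eq`) -/

/-- **THE OWNER's SINGLE-PLAQUETTE MASS ON `SU(2)`, SHARP CEILING**: `linkMass β < (2√π)⁻¹·((√(β∕2))⁻¹)³` for every `β > 0`
(V43's `linkMass_SU2_le_explicit` had `π²√π∕16 = 1.0933`; the constant `(2√π)⁻¹ = 0.28209` is the supremum of `(β∕2)^{3∕2}·linkMass β`). [folklore] -/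
theorem linkMass_SU2_lt_sharp {β : ℝ} (hβ : 0 < β) :
    linkMass (G := Matrix.specialUnitaryGroup (Fin 2) ℂ) β < (2 * Real.sqrt Real.pi)⁻¹ * ((Real.sqrt (β / 2))⁻¹) ^ 3 := by
  rw [linkMass_SU_eq]
  exact plaquetteMass_SU2_lt_sharp (β := β / 2) (by positivity)

/-- **THE OWNER's SINGLE-PLAQUETTE MASS ON `SU(2)`, FLOOR BY VALUE**: `(3√3∕8)·e^{−3∕2}·((√(β∕2))⁻¹)³ ≤ linkMass β` for `β ≥ 3∕2` (V44's tangent floor;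
V43's floor was `e⁻¹∕8·(…)` for `β ≥ 1∕2`). [folklore] -/
theorem tangentFloor_le_linkMass_SU2 {β : ℝ} (hβ : 3 / 2 ≤ β) :
    3 * Real.sqrt 3 / 8 * Real.exp (-(3 / 2)) * ((Real.sqrt (β / 2))⁻¹) ^ 3 ≤ linkMass (G := Matrix.specialUnitaryGroup (Fin 2) ℂ) β := by
  rw [linkMass_SU_eq]
  exact tangentFloor_le_plaquetteMass_SU2 (β := β / 2) (by linarith)

variable {F : T4Family} in
/-- **THE BARE TORUS PARTITION FUNCTION WITH THE SHARP ONE-PLAQUETTE CONSTANT**: `Z_K(β) ≤ ((2√π)⁻¹·((√(β∕2))⁻¹)³)^{2·L^{m+K}}` for EVERY `K` and EVERY `β > 0`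
(the owner's `partitionFn_T4_le` with `linkMass_SU2_lt_sharp`; V43's base `1.0933·(β∕2)^{−3∕2}` becomes `0.28209·(β∕2)^{−3∕2}`, `< 1` as soon as `β > 2·(2√π)^{−2∕3} = 0.860…`). [folklore] -/
theorem partitionFn_T4_SU2_le_sharp (K : ℕ) {β : ℝ} (hβ : 0 < β) :
    partitionFn (G := Matrix.specialUnitaryGroup (Fin 2) ℂ) (F.P K) β
      ≤ ((2 * Real.sqrt Real.pi)⁻¹ * ((Real.sqrt (β / 2))⁻¹) ^ 3) ^ (2 * F.L ^ (F.m + K)) :=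
  (partitionFn_T4_le K hβ.le).trans (pow_le_pow_left₀ (linkMass_nonneg β) (linkMass_SU2_lt_sharp hβ).le _)

/-! ### The two-sided rate (with V47's Laplace floor) -/

/-- **THE LAPLACE LIMIT WITH RATE, TWO-SIDED**: for `β > 0`, `|(√β)³·∫ e^{−β·Re tr(1−U)} dHaar_{SU(2)}(U) − (2√π)⁻¹| ≤ (2√π)⁻¹∕(2β)` — below by V47's elementary
floor `(2√π)⁻¹(1 − 1∕(2β))`, above by the sharp ceiling of this file (`f < (2√π)⁻¹`); by value `0.14105∕β` against the true next Laplace term `0.0529∕β`. [folklore] -/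
theorem abs_scaled_plaquetteMass_SU2_sub_limit_le {β : ℝ} (hβ : 0 < β) :
    |Real.sqrt β ^ 3 * ∫ U, Real.exp (-(β * (Matrix.trace (1 - (U : Matrix (Fin 2) (Fin 2) ℂ))).re)) ∂(haarProbability (Matrix.specialUnitaryGroup (Fin 2) ℂ))
        - (2 * Real.sqrt Real.pi)⁻¹| ≤ (2 * Real.sqrt Real.pi)⁻¹ / (2 * β) := by
  have hlo := laplaceFloor_le_scaled_plaquetteMass_SU2 hβ
  have hhi := scaled_plaquetteMass_SU2_lt_limit hβ.le
  have hL : 0 < (2 * Real.sqrt Real.pi)⁻¹ := by positivity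
  have e : (2 * Real.sqrt Real.pi)⁻¹ * (1 - 1 / (2 * β)) = (2 * Real.sqrt Real.pi)⁻¹ - (2 * Real.sqrt Real.pi)⁻¹ / (2 * β) := by ring
  rw [abs_le]
  constructor
  · linarith
  · have : 0 ≤ (2 * Real.sqrt Real.pi)⁻¹ / (2 * β) := by positivity
    linarith

end Summit.QuantumFields.BalabanUV.T4Continuum.NE7b.CompactFibrePlaquetteMassSU2Sharp

end
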